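import Literature.AlgebraicTopology.KTheory.BottClutching
import HarnessLib

/-!
# Bott classes `[θ, g]` of invertible clutching matrices of trivial bundles

For `g ∈ GL_ι(C(X × S¹, ℂ))` the idempotents over `X × S²` glued from trivial local models with
transition `g` (`IsClutchedGL Q g`) exist and are unique up to algebraic equivalence; their class is
`bottClassGL g ∈ K⁰(X × S²)` (zero if `g` is not invertible). Rules: re-indexing invariance,
additivity over block sums (`bottClassGL_fromBlocks`), naturality (`pullback_baseMap_bottClassGL`),
homotopy invariance for families over `X × [0,1]` (`bottClassGL_slice_eq`, `bottClassGL_eq_of_homotopy`),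
and the **reduction of general clutching data to invertible matrices**
`bottClass_add_pullback_compl : [ζ, u] + pr₁^*[ζᶜ] = [θ, u + (1 - Z)]` (re-framing
`(ζ, u) ⊕ (ζᶜ, 1)` by `ζ ⊕ ζᶜ ≅ θ`). This is the setting in which the linearisation and
spectral-projection steps of Bott periodicity are carried out (Husemöller, *Fibre Bundles*,
Ch. 11 §§3–5, for the trivial bundle). Everything is proved; no named facts.

## References

* D. Husemöller, *Fibre Bundles*, 3rd ed. (1994) [HusemollerFibreBundles1994]: Ch. 10 Prop. 1.5,
  Ch. 11 Prop. 2.3, Notation 2.7, (2.6).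
-/

noncomputable section

open Set Metric unitInterval

namespace Literature.AlgebraicTopology.KTheory

open Literature.RingTheory.KTheory Matrix

universe u

variable {X : Type u} [TopologicalSpace X]

/-- **`Q` is clutched from the invertible matrix `g` over `X × S¹`** (trivial local models):
`Q ≅ θ ∪_g θ = [θ, g]`. [cite: HusemollerFibreBundles1994, Ch. 11 Notation 2.7] -/
def IsClutchedGL {m ι : Type*} [Fintype m] [Fintype ι] [DecidableEq ι] (Q : Matrix m m C(X × S2r, ℂ))
    (g : Matrix ι ι C(↥(pieceUp X ∩ pieceDn X), ℂ)) : Prop :=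
  ∃ w : GluingWitness Q (1 : Matrix ι ι C(↥(pieceUp X), ℂ)) (1 : Matrix ι ι C(↥(pieceDn X), ℂ)), w.g = g

namespace IsClutchedGL

variable {m ι : Type*} [Fintype m] [Fintype ι] [DecidableEq ι]
variable {Q : Matrix m m C(X × S2r, ℂ)} {g : Matrix ι ι C(↥(pieceUp X ∩ pieceDn X), ℂ)}

/-- Auxiliary statement for Bott classes of invertible clutching matrices. [folklore] -/
theorem isIdempotentElem (h : IsClutchedGL Q g) : IsIdempotentElem Q := by
  obtain ⟨w, -⟩ := h; exact w.isIdempotentElem pieceUp_union_pieceDn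

/-- **Uniqueness.** [cite: HusemollerFibreBundles1994, Ch. 11 Prop. 2.3] -/
theorem algEquivalent {m' : Type*} [Fintype m'] {Q' : Matrix m' m' C(X × S2r, ℂ)} (h : IsClutchedGL Q g) (h' : IsClutchedGL Q' g) :
    AlgEquivalent Q Q' := by
  obtain ⟨w, hw⟩ := h
  obtain ⟨w', hw'⟩ := h'
  exact w.algEquivalent_of_g_eq isClosed_pieceUp isClosed_pieceDn pieceUp_union_pieceDn w' (hw.trans hw'.symm)

/-- Re-indexing the glued matrix. [folklore] -/
theorem reindex {m' : Type*} [Fintype m'] (h : IsClutchedGL Q g) (e : m ≃ m') : IsClutchedGL (Matrix.reindex e e Q) g := by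
  obtain ⟨w, hw⟩ := h
  exact ⟨w.reindexTotal (w.isIdempotentElem pieceUp_union_pieceDn) e, (w.g_reindexTotal _ e).trans hw⟩

/-- Re-indexing the clutching matrix. [folklore] -/
theorem reindexGL {ι' : Type*} [Fintype ι'] [DecidableEq ι'] (h : IsClutchedGL Q g) (e : ι ≃ ι') :
    IsClutchedGL Q (Matrix.reindex e e g) := by
  obtain ⟨w, hw⟩ := h
  refine ⟨(w.reindexModels e e).castModels (by simp) (by simp), ?_⟩
  rw [GluingWitness.g_castModels, GluingWitness.g_reindexModels, hw]

/-- A transition between trivial models is invertible. [folklore] -/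
theorem isUnit (h : IsClutchedGL Q g) : IsUnit g := by
  obtain ⟨w, hw⟩ := h
  have h1 := w.g_mul_h
  have h2 := w.h_mul_g
  rw [Matrix.map_one _ (map_zero _) (map_one _)] at h1 h2
  rw [← hw]
  exact ⟨⟨w.g, w.h, h1, h2⟩, rfl⟩

/-- **Sum**: `Q ⊕ Q'` is clutched from `g ⊕ g'`. [cite: HusemollerFibreBundles1994, Ch. 10 Prop. 1.5] -/
theorem sum {m' ι' : Type*} [Fintype m'] [Fintype ι'] [DecidableEq ι'] {Q' : Matrix m' m' C(X × S2r, ℂ)}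
    {g' : Matrix ι' ι' C(↥(pieceUp X ∩ pieceDn X), ℂ)} (h : IsClutchedGL Q g) (h' : IsClutchedGL Q' g') :
    IsClutchedGL (Matrix.fromBlocks Q 0 0 Q') (Matrix.fromBlocks g 0 0 g') := by
  obtain ⟨w, hw⟩ := h
  obtain ⟨w', hw'⟩ := h'
  refine ⟨(w.sum w').castModels (Matrix.fromBlocks_one) (Matrix.fromBlocks_one), ?_⟩
  rw [GluingWitness.g_castModels, GluingWitness.g_sum, hw, hw']

/-- **Base change** along `f : X' → X`. [cite: HusemollerFibreBundles1994, Ch. 11 Notation 2.7] -/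
theorem baseChange {X' : Type*} [TopologicalSpace X'] (h : IsClutchedGL Q g) (f : C(X', X)) :
    IsClutchedGL (Q.map (comapRingHom (baseMap f)))
      (g.map (comapRingHom (restrictMap (baseMap f) (mapsTo_inter (mapsTo_baseMap_pieceUp f) (mapsTo_baseMap_pieceDn f))))) := by
  obtain ⟨w, hw⟩ := h
  refine ⟨(w.comap (baseMap f) (mapsTo_baseMap_pieceUp f) (mapsTo_baseMap_pieceDn f)).castModels
    (Matrix.map_one _ (map_zero _) (map_one _)) (Matrix.map_one _ (map_zero _) (map_one _)), ?_⟩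
  rw [GluingWitness.g_castModels, GluingWitness.g_comap, hw]

end IsClutchedGL

/-! ### Existence and the class `bottClassGL g` -/

section GLClass

variable [CompactSpace X] [T2Space X]
variable {ι : Type*} [Fintype ι] [DecidableEq ι]

/-- **Existence**: every invertible matrix over `X × S¹` is the clutching matrix of an idempotent over
`X × S²` with trivial local models. [cite: HusemollerFibreBundles1994, Ch. 11 Notation 2.7] -/
theorem exists_isClutchedGL (g : Matrix ι ι C(↥(pieceUp X ∩ pieceDn X), ℂ)) (hg : IsUnit g) :
    ∃ Q : Matrix (ι ⊕ ι) (ι ⊕ ι) C(X × S2r, ℂ), IsClutchedGL Q g := by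
  obtain ⟨gu, rfl⟩ := hg
  obtain ⟨Q, w, hwg⟩ := exists_gluingWitness (Y := X × S2r) isClosed_pieceUp isClosed_pieceDn pieceUp_union_pieceDn
    (P₁ := (1 : Matrix ι ι C(↥(pieceUp X), ℂ))) (P₂ := (1 : Matrix ι ι C(↥(pieceDn X), ℂ))) IsIdempotentElem.one IsIdempotentElem.one
    (gu : Matrix ι ι _) ↑gu⁻¹ gu.mul_inv gu.inv_mul
    (by rw [Matrix.map_one _ (map_zero _) (map_one _), Matrix.map_one _ (map_zero _) (map_one _), Matrix.mul_one, gu.mul_inv])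
  refine ⟨Q, w, ?_⟩
  rw [hwg, Matrix.map_one _ (map_zero _) (map_one _), Matrix.map_one _ (map_zero _) (map_one _), Matrix.one_mul, Matrix.mul_one]

/-- **The Bott class `[θ, g] ∈ K⁰(X × S²)` of an invertible clutching matrix** (the class of the
zero idempotent if `g` is not invertible). [cite: HusemollerFibreBundles1994, Ch. 11 Notation 2.7] -/
def bottClassGL (g : Matrix ι ι C(↥(pieceUp X ∩ pieceDn X), ℂ)) : K0 (X × S2r) :=
  haveI := Classical.dec (IsUnit g)
  if hg : IsUnit g then
    KZero.of (Idem.ofMatrix (Classical.choose (exists_isClutchedGL g hg)) (Classical.choose_spec (exists_isClutchedGL g hg)).isIdempotentElem)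
  else 0

/-- Any idempotent clutched from `g` represents `bottClassGL g`. [cite: HusemollerFibreBundles1994, Ch. 11 Prop. 2.3] -/
theorem IsClutchedGL.of_ofMatrix_eq {m : Type*} [Fintype m] {Q : Matrix m m C(X × S2r, ℂ)} {g : Matrix ι ι C(↥(pieceUp X ∩ pieceDn X), ℂ)}
    (hQ : IsClutchedGL Q g) : KZero.of (Idem.ofMatrix Q hQ.isIdempotentElem) = bottClassGL g := by
  classical
  rw [bottClassGL, dif_pos hQ.isUnit]
  apply KZero.of_eq_of
  refine (Idem.algEquivalent_ofMatrix Q hQ.isIdempotentElem).trans ?_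
  exact (hQ.algEquivalent (Classical.choose_spec (exists_isClutchedGL g hQ.isUnit))).trans (Idem.algEquivalent_ofMatrix _ _).symm

/-- A `Fin`-indexed idempotent clutched from `g` represents `bottClassGL g`. [cite: HusemollerFibreBundles1994, Ch. 11 Prop. 2.3] -/
theorem IsClutchedGL.of_eq (q : Idem C(X × S2r, ℂ)) {g : Matrix ι ι C(↥(pieceUp X ∩ pieceDn X), ℂ)} (hq : IsClutchedGL q.mat g) :
    KZero.of q = bottClassGL g := by
  rw [← hq.of_ofMatrix_eq]
  exact KZero.of_eq_of (Idem.algEquivalent_ofMatrix q.mat hq.isIdempotentElem).symm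

/-- A chosen `Fin`-indexed representative. [folklore] -/
theorem exists_idem_isClutchedGL (g : Matrix ι ι C(↥(pieceUp X ∩ pieceDn X), ℂ)) (hg : IsUnit g) :
    ∃ q : Idem C(X × S2r, ℂ), IsClutchedGL q.mat g := by
  obtain ⟨Q, hQ⟩ := exists_isClutchedGL g hg
  exact ⟨Idem.ofMatrix Q hQ.isIdempotentElem, hQ.reindex _⟩

/-- **Re-indexing invariance.** [folklore] -/
theorem bottClassGL_reindex {ι' : Type*} [Fintype ι'] [DecidableEq ι'] (g : Matrix ι ι C(↥(pieceUp X ∩ pieceDn X), ℂ)) (e : ι ≃ ι') :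
    bottClassGL (Matrix.reindex e e g) = bottClassGL g := by
  by_cases hg : IsUnit g
  · obtain ⟨q, hq⟩ := exists_idem_isClutchedGL g hg
    rw [← hq.of_eq, (hq.reindexGL e).of_eq]
  · have hg' : ¬ IsUnit (Matrix.reindex e e g) := fun h ↦ hg (by
      have := h.map (Matrix.reindexAlgEquiv ℂ _ e).symm
      simpa using this)
    classical
    rw [bottClassGL, bottClassGL, dif_neg hg, dif_neg hg']

/-- **Additivity**: `[θ, g ⊕ g'] = [θ, g] + [θ, g']`. [cite: HusemollerFibreBundles1994, Ch. 10 Prop. 1.5] -/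
theorem bottClassGL_fromBlocks {ι' : Type*} [Fintype ι'] [DecidableEq ι'] (g : Matrix ι ι C(↥(pieceUp X ∩ pieceDn X), ℂ))
    (g' : Matrix ι' ι' C(↥(pieceUp X ∩ pieceDn X), ℂ)) (hg : IsUnit g) (hg' : IsUnit g') :
    bottClassGL (Matrix.fromBlocks g 0 0 g') = bottClassGL g + bottClassGL g' := by
  obtain ⟨q, hq⟩ := exists_idem_isClutchedGL g hg
  obtain ⟨q', hq'⟩ := exists_idem_isClutchedGL g' hg'
  have hs : IsClutchedGL (q + q').mat (Matrix.fromBlocks g 0 0 g') := (hq.sum hq').reindex _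
  rw [← hs.of_eq, KZero.of_add, hq.of_eq, hq'.of_eq]

/-- **Naturality**: `(f × id)^* [θ, g] = [θ, f^* g]`. [cite: HusemollerFibreBundles1994, Ch. 11 Notation 2.7] -/
theorem pullback_baseMap_bottClassGL {X' : Type*} [TopologicalSpace X'] [CompactSpace X'] [T2Space X']
    (g : Matrix ι ι C(↥(pieceUp X ∩ pieceDn X), ℂ)) (hg : IsUnit g) (f : C(X', X)) :
    pullback (baseMap f) (bottClassGL g) =
      bottClassGL (g.map (comapRingHom (restrictMap (baseMap f) (mapsTo_inter (mapsTo_baseMap_pieceUp f) (mapsTo_baseMap_pieceDn f))))) := by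
  obtain ⟨q, hq⟩ := exists_idem_isClutchedGL g hg
  rw [← hq.of_eq, pullback_of]
  exact (hq.baseChange f).of_eq (q.map (comapRingHom (baseMap f)))

/-- **Homotopy invariance**: the slices of an invertible matrix over `(X × [0,1]) × S¹` have the same
Bott class. [cite: HusemollerFibreBundles1994, Ch. 11 (2.6)] -/
theorem bottClassGL_slice_eq (G : Matrix ι ι C(↥(pieceUp (X × I) ∩ pieceDn (X × I)), ℂ)) (hG : IsUnit G) (s t : I) :
    bottClassGL (G.map (comapRingHom (restrictMap (baseMap (sliceIncl s))
        (mapsTo_inter (mapsTo_baseMap_pieceUp _) (mapsTo_baseMap_pieceDn _))))) =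
      bottClassGL (G.map (comapRingHom (restrictMap (baseMap (sliceIncl t))
        (mapsTo_inter (mapsTo_baseMap_pieceUp _) (mapsTo_baseMap_pieceDn _))))) := by
  rw [← pullback_baseMap_bottClassGL G hG, ← pullback_baseMap_bottClassGL G hG,
    pullback_eq_of_homotopic ((sliceIncl_homotopic s t).prodMap (ContinuousMap.Homotopic.refl (ContinuousMap.id S2r)))]

/-- User form of homotopy invariance: invertible `G` over `(X × [0,1]) × S¹` with slices `g₀`, `g₁`
gives `[θ, g₀] = [θ, g₁]`. [cite: HusemollerFibreBundles1994, Ch. 11 (2.6)] -/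
theorem bottClassGL_eq_of_homotopy (g₀ g₁ : Matrix ι ι C(↥(pieceUp X ∩ pieceDn X), ℂ))
    (G : Matrix ι ι C(↥(pieceUp (X × I) ∩ pieceDn (X × I)), ℂ)) (hG : IsUnit G)
    (h₀ : G.map (comapRingHom (restrictMap (baseMap (sliceIncl 0))
        (mapsTo_inter (mapsTo_baseMap_pieceUp _) (mapsTo_baseMap_pieceDn _)))) = g₀)
    (h₁ : G.map (comapRingHom (restrictMap (baseMap (sliceIncl 1))
        (mapsTo_inter (mapsTo_baseMap_pieceUp _) (mapsTo_baseMap_pieceDn _)))) = g₁) :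
    bottClassGL g₀ = bottClassGL g₁ := by
  rw [← h₀, ← h₁]; exact bottClassGL_slice_eq G hG 0 1

/-! ### Reduction of general clutching data to invertible matrices -/

omit [CompactSpace X] [T2Space X] in
/-- The frame `P ⊕ (1 - P) ∼ 1`: `fromRows P (1-P) · fromCols P (1-P) = P ⊕ (1-P)`. [folklore] -/
theorem fromRows_compl_mul_fromCols_compl {R : Type*} [CommRing R] {P : Matrix ι ι R} (hP : IsIdempotentElem P) :
    Matrix.fromRows P (1 - P) * Matrix.fromCols P (1 - P) = Matrix.fromBlocks P 0 0 (1 - P) := by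
  rw [Matrix.fromRows_mul_fromCols, hP.eq, hP.one_sub.eq, Matrix.mul_sub, Matrix.sub_mul, Matrix.mul_one, Matrix.one_mul, hP.eq,
    sub_self]

omit [CompactSpace X] [T2Space X] in
/-- The frame `P ⊕ (1 - P) ∼ 1`: `fromCols P (1-P) · fromRows P (1-P) = 1`. [folklore] -/
theorem fromCols_compl_mul_fromRows_compl {R : Type*} [CommRing R] {P : Matrix ι ι R} (hP : IsIdempotentElem P) :
    Matrix.fromCols P (1 - P) * Matrix.fromRows P (1 - P) = 1 := by
  rw [Matrix.fromCols_mul_fromRows, hP.eq, hP.one_sub.eq, add_sub_cancel]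

omit [CompactSpace X] [T2Space X] in
/-- The complement `pr₁^*(1 - ζ)` is glued from `1 - π_±^* ζ` with transition `1 - Z`. [folklore] -/
def complWitness (ζ : Idem C(X, ℂ)) :
    GluingWitness (((1 : Matrix (Fin ζ.size) (Fin ζ.size) C(X, ℂ)) - ζ.mat).map (comapRingHom (prX X)))
      (1 - pullUp ζ) (1 - pullDn ζ) :=
  have e₁ : (((1 : Matrix (Fin ζ.size) (Fin ζ.size) C(X, ℂ)) - ζ.mat).map (comapRingHom (prX X))).map (resHom (pieceUp X)) =
      1 - pullUp ζ := by
    rw [Matrix.map_sub _ (map_sub _), Matrix.map_sub _ (map_sub _), Matrix.map_one _ (map_zero _) (map_one _),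
      Matrix.map_one _ (map_zero _) (map_one _), map_prX_map_resHom_pieceUp]
  have e₂ : (((1 : Matrix (Fin ζ.size) (Fin ζ.size) C(X, ℂ)) - ζ.mat).map (comapRingHom (prX X))).map (resHom (pieceDn X)) =
      1 - pullDn ζ := by
    rw [Matrix.map_sub _ (map_sub _), Matrix.map_sub _ (map_sub _), Matrix.map_one _ (map_zero _) (map_one _),
      Matrix.map_one _ (map_zero _) (map_one _), map_prX_map_resHom_pieceDn]
  have h₁ := (isIdempotentElem_pullUp ζ).one_sub.eq
  have h₂ := (isIdempotentElem_pullDn ζ).one_sub.eq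
  { x₁ := 1 - pullUp ζ, y₁ := 1 - pullUp ζ, x₂ := 1 - pullDn ζ, y₂ := 1 - pullDn ζ,
    hxy₁ := by rw [e₁, h₁], hyx₁ := h₁, hx₁ := by rw [h₁, h₁], hy₁ := by rw [h₁, h₁],
    hxy₂ := by rw [e₂, h₂], hyx₂ := h₂, hx₂ := by rw [h₂, h₂], hy₂ := by rw [h₂, h₂] }

omit [CompactSpace X] [T2Space X] in
/-- Auxiliary statement for Bott classes of invertible clutching matrices. [folklore] -/
theorem g_complWitness (ζ : Idem C(X, ℂ)) : (complWitness ζ).g = 1 - pullA ζ := by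
  change (1 - pullDn ζ).map (ovl₂ (pieceUp X) (pieceDn X)) * (1 - pullUp ζ).map (ovl₁ (pieceUp X) (pieceDn X)) = _
  rw [Matrix.map_sub _ (map_sub _), Matrix.map_sub _ (map_sub _), Matrix.map_one _ (map_zero _) (map_one _),
    Matrix.map_one _ (map_zero _) (map_one _), pullDn_map_ovl₂, pullUp_map_ovl₁, (isIdempotentElem_pullA ζ).one_sub.eq]

omit [CompactSpace X] [T2Space X] in
/-- The class of the complement representative is `pr₁^*[ζᶜ]`. [folklore] -/
theorem of_ofMatrix_compl (ζ : Idem C(X, ℂ)) :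
    KZero.of (Idem.ofMatrix (((1 : Matrix (Fin ζ.size) (Fin ζ.size) C(X, ℂ)) - ζ.mat).map (comapRingHom (prX X)))
      ((complWitness ζ).isIdempotentElem pieceUp_union_pieceDn)) = pullback (prX X) (KZero.of ζ.compl) := by
  rw [pullback_of]
  exact KZero.of_eq_of (Idem.algEquivalent_ofMatrix _ _)

/-- **Reduction to invertible matrices**: `[ζ, u] + pr₁^*[ζᶜ] = [θ, ũ]` with `ũ = u + (1 - Z)` the
extension of `u` by the identity of the complement (the clutching data `(ζ, u) ⊕ (ζᶜ, 1)` re-framed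
by `ζ ⊕ ζᶜ ≅ θ`). [cite: HusemollerFibreBundles1994, Ch. 11 Prop. 2.3] -/
theorem bottClass_add_pullback_compl {ζ : Idem C(X, ℂ)} (c : ClutchingFn ζ) :
    bottClass ζ c + pullback (prX X) (KZero.of ζ.compl) = bottClassGL c.ext := by
  -- representatives
  set q : Idem C(X × S2r, ℂ) := Idem.ofMatrix _ (Classical.choose_spec (exists_isClutched ζ c)).isIdempotentElem
  have hq : IsClutched q.mat ζ c := (Classical.choose_spec (exists_isClutched ζ c)).reindex _
  obtain ⟨w, hw⟩ := hq
  have hPu := isIdempotentElem_pullUp ζ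
  have hPd := isIdempotentElem_pullDn ζ
  -- the sum witness, re-framed by `P ⊕ (1 - P) ∼ 1`
  let wr := (w.sum (complWitness ζ)).reframe (Matrix.fromRows (pullUp ζ) (1 - pullUp ζ)) (Matrix.fromCols (pullUp ζ) (1 - pullUp ζ))
    (fromRows_compl_mul_fromCols_compl hPu) (fromCols_compl_mul_fromRows_compl hPu)
    (by rw [fromCols_compl_mul_fromRows_compl hPu, Matrix.one_mul])
    (Matrix.fromRows (pullDn ζ) (1 - pullDn ζ)) (Matrix.fromCols (pullDn ζ) (1 - pullDn ζ))
    (fromRows_compl_mul_fromCols_compl hPd) (fromCols_compl_mul_fromRows_compl hPd)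
    (by rw [fromCols_compl_mul_fromRows_compl hPd, Matrix.one_mul])
  have hGL : IsClutchedGL (Matrix.fromBlocks q.mat 0 0
      ((((1 : Matrix (Fin ζ.size) (Fin ζ.size) C(X, ℂ)) - ζ.mat).map (comapRingHom (prX X))))) c.ext := by
    refine ⟨wr, ?_⟩
    rw [GluingWitness.g_reframe, GluingWitness.g_sum, hw, g_complWitness, Matrix.fromCols_map, Matrix.fromRows_map,
      Matrix.map_sub _ (map_sub _), Matrix.map_sub _ (map_sub _), Matrix.map_one _ (map_zero _) (map_one _),
      Matrix.map_one _ (map_zero _) (map_one _), pullDn_map_ovl₂, pullUp_map_ovl₁, Matrix.fromCols_mul_fromBlocks,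
      Matrix.fromCols_mul_fromRows, Matrix.mul_zero, Matrix.mul_zero, add_zero, zero_add, c.pullA_mul_u, c.u_mul_pullA,
      (isIdempotentElem_pullA ζ).one_sub.eq, (isIdempotentElem_pullA ζ).one_sub.eq]
    rfl
  rw [← hGL.of_ofMatrix_eq, ← of_ofMatrix_compl ζ, ← (show IsClutched q.mat ζ c from ⟨w, hw⟩).of_eq, ← KZero.of_add]
  apply KZero.of_eq_of
  refine (Idem.add_equiv_fromBlocks q _).trans (AlgEquivalent.trans ?_
    (Idem.algEquivalent_ofMatrix (Matrix.fromBlocks q.mat 0 0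
      ((((1 : Matrix (Fin ζ.size) (Fin ζ.size) C(X, ℂ)) - ζ.mat).map (comapRingHom (prX X))))) hGL.isIdempotentElem).symm)
  exact AlgEquivalent.fromBlocks (AlgEquivalent.refl q.isIdempotentElem) (Idem.algEquivalent_ofMatrix _ _)

end GLClass

end Literature.AlgebraicTopology.KTheory

end
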